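import Summits.HubbardSuperconductivity.HubbardSuperconductivity.Theorems.BalabanIRBirComplexStableXYRCoulombFieldLaplacian
import Summits.HubbardSuperconductivity.HubbardSuperconductivity.Theorems.BalabanIRBirComplexStableXYRGreenDecay
import HarnessLib

/-!
# Crux `BirComplexStableXYR` (stmt-HubbardSuperconductivity-14845), chapter-2 input (lead c7, item G2c): the BIOT–SAVART LAW
# for the Coulomb representative of a vortex current on the space–time torus

Support file (prover seat 1, route BalabanIR).  The coexact (Coulomb-gauge) `1`-cochain `coexact q = δ₂ (G q)` of a `2`-cochain
`q` on `Λ L M = (ℤ/L)² × ℤ/M` (`Literature/…/TorusChartHodgeDecomposition.lean`; for `q = d₁ a` the strain class representative of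
the vortex current in lead c7's representation, `σ_a = harm₁(2πa) + (1 − Π_𝒬)(2π·coexact (d₁ a))`) is given by first differences of
the torus Green's function applied to `q`; by the volume-uniform dipole decay of those differences
(`Literature/Analysis/Matrix/TorusGreenGradientDecay{,Temporal}.lean`, instantiated through `…CoulombFieldLaplacian.lean`):

* `birCoulombField_decay` (registered stub) — for `L ≤ M`, every real `2`-cochain `q`, site `x` and direction `i`:
  `|coexact q (x,i)| ≤ Σ_j Σ_y |q(y;i,j)| · (C₁ / max(1, (d(x − e_j, y) − 1)/4)² + C₂ / L²)`
  with absolute constants `C₁, C₂` (the `k = 1`, `m = 2`, `c₀ = 1/3`, `R = 1` constants of the Literature files): the field of a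
  unit plaquette current decays like the inverse square of the torus distance up to the spatial period — the lattice Biot–Savart
  law, uniformly in the volume — and is `O(L⁻²)` beyond it.

No definitions; sorry-free. [folklore]
-/

noncomputable section

namespace Summit.HubbardSuperconductivity.HubbardSuperconductivity.Theorems

set_option linter.dupNamespace false -- summit = problem name (single-conjunct summit), D-0017

open scoped BigOperators Matrix ComplexConjugate
open Complex Summit.HubbardSuperconductivity.BirComplexStableXYNegative
open Literature.Probability.LatticeModels Literature.Analysis.Matrix Literature.Analysis.Fourier
open Literature.MathematicalPhysics.QuantumFieldTheory

section CoulombField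

variable {L M : ℕ} [NeZero L] [NeZero M]

-- the three unit steps of the space-time torus (local abbreviation; inline in statements)
set_option quotPrecheck false in
local notation "Evec[" L' "," M' "]" =>
  (![((![1, 0] : Literature.Probability.LatticeModels.TorusSite 2 L'), (0 : ZMod M')), (![0, 1], 0), (0, 1)]
    : Fin 3 → Λ L' M')

-- the inline lattice Laplacian matrix (local abbreviation; inline in statements)
set_option quotPrecheck false in
local notation "NL[" L' "," M' "]" => (Matrix.of fun x y : Λ L' M' =>
  ∑ i : Fin 3, (((if y = x then (1 : ℝ) else 0) - (if y = x + Evec[L',M'] i then (1 : ℝ) else 0))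
    + ((if y = x then (1 : ℝ) else 0) - (if y = x - Evec[L',M'] i then (1 : ℝ) else 0))))

-- the torus `ℓ¹` distance (local abbreviation; inline in statements)
set_option quotPrecheck false in
local notation "tdist[" L' "," M' "]" => (fun i j : Λ L' M' =>
  ((j.1 0 - i.1 0).valMinAbs.natAbs + (j.1 1 - i.1 1).valMinAbs.natAbs + (j.2 - i.2).valMinAbs.natAbs))

/-! ## Scaling of the pseudo-inverse -/

/-- `pinv (c • A) = c⁻¹ • pinv A` for a real scalar `c`. [folklore] -/
theorem cf_pinv_smul (c : ℝ) (A : Matrix (Λ L M) (Λ L M) ℝ) : pinv (c • A) = c⁻¹ • pinv A := by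
  funext x y
  simp only [pinv, mulKernel_apply, mulKernelC_apply, Matrix.smul_apply, smul_eq_mul, symbol_smul, mul_inv,
    Finset.mul_sum]
  rw [Complex.re_sum, Complex.re_sum, Finset.mul_sum]
  refine Finset.sum_congr rfl fun ψ _ => ?_
  rw [show ((Fintype.card (Λ L M) : ℂ))⁻¹ * (((c : ℂ))⁻¹ * (symbol A ψ)⁻¹ * ψ (x - y))
      = ((c⁻¹ : ℝ) : ℂ) * (((Fintype.card (Λ L M) : ℂ))⁻¹ * ((symbol A ψ)⁻¹ * ψ (x - y))) by push_cast; ring,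
    Complex.re_ofReal_mul]

/-- The Laplacian as three times the rescaled one: `pinv NL = (1/3)⁻¹⁻¹… = 3⁻¹ • pinv (NL/3)`. [folklore] -/
theorem cf_pinv_NL : pinv (NL[L,M]) = (3 : ℝ)⁻¹ • pinv (((1 / 3 : ℝ)) • NL[L,M]) := by
  rw [cf_pinv_smul, one_div, inv_inv, smul_smul, inv_mul_cancel₀ (by norm_num : (3 : ℝ) ≠ 0), one_smul]

/-! ## The coexact cochain through first differences of the Green's function -/

/-- **`coexact q` is a superposition of first differences of the torus Green's function**:
`coexact q (x,i) = Σ_j Σ_y ∇_{e_j} (pinv NL)(x − e_j, y) · q(y;i,j)`. [folklore] -/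
theorem cf_coexact_eq (q : Λ L M → Fin 3 → Fin 3 → ℝ) (x : Λ L M) (i : Fin 3) :
    (TorusChart.piProdZMod 2 L M).coexact q x i
      = ∑ j : Fin 3, ∑ y : Λ L M, rowDiff (Evec[L,M] j) (pinv (NL[L,M])) (x - Evec[L,M] j) y * q y i j := by
  rw [TorusChart.coexact_def, TorusChart.δ₂_apply]
  refine Finset.sum_congr rfl fun j _ => ?_
  rw [TorusChart.green₂_apply, TorusChart.green₂_apply, cfl_green_eq_pinv_mulVec, cfl_gen_eq]
  simp only [Matrix.mulVec, dotProduct, rowDiff_apply, sub_add_cancel, sub_mul, Finset.sum_sub_distrib]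

/-! ## The Biot–Savart law (registered stub) -/

/-- **Registered stub `birCoulombField_decay` (prover seat 1, stmt-HubbardSuperconductivity-14845; lead c7 chapter-2 input G2c):
the lattice Biot–Savart law on the space–time torus, uniformly in the volume.**  For `L ≤ M`, every real `2`-cochain `q`,
site `x` and direction `i`: `|coexact q (x,i)| ≤ Σ_j Σ_y |q(y;i,j)| · (C₁/max(1,(d(x − e_j, y) − 1)/4)² + C₂/L²)`. [folklore] -/
theorem birCoulombField_decay : ∀ (L M : ℕ) [NeZero L] [NeZero M], L ≤ M → ∀ (q : Λ L M → Fin 3 → Fin 3 → ℝ) (x : Λ L M) (i : Fin 3), |(Literature.MathematicalPhysics.QuantumFieldTheory.TorusChart.piProdZMod 2 L M).coexact q x i| ≤ ∑ j : Fin 3, ∑ y : Λ L M, |q y i j| * ((3 : ℝ)⁻¹ * (2 * (27 * (2 : ℕ) * (2 * Real.pi) / 4 * (1 + 2 ^ 5 * Real.pi ^ (2 * (2 : ℕ) + 2) / (16 * (1 / 3 : ℝ)) ^ ((2 : ℕ) + 1)))) * (1 / max 1 (((((y.1 0 - (x - (![((![1, 0] : Literature.Probability.LatticeModels.TorusSite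 2 L), (0 : ZMod M)), (![0, 1], 0), (0, 1)] : Fin 3 → Λ L M) j).1 0).valMinAbs.natAbs + (y.1 1 - (x - (![((![1, 0] : Literature.Probability.LatticeModels.TorusSite 2 L), (0 : ZMod M)), (![0, 1], 0), (0, 1)] : Fin 3 → Λ L M) j).1 1).valMinAbs.natAbs + (y.2 - (x - (![((![1, 0] : Literature.Probability.LatticeModels.TorusSite 2 L), (0 : ZMod M)), (![0, 1], 0), (0, 1)] : Fin 3 → Λ L M) j).2).valMinAbs.natAbs : ℕ) : ℝ) - 1) / (2 * (2 : ℕ) * (1 : ℕ)))) ^ 2 + (3 : ℝ)⁻¹ * (2 * (27 * (2 : ℕ) * (2 * Real.pi) * Real.pi ^ (2 * (2 : ℕ) + 2) * 2 ^ 5 / (4 * (16 * (1 / 3 : ℝ)) ^ ((2 : ℕ) + 1))) + 16 * (2 : ℕ) * (1 : ℕ) * ((27 * (2 : ℕ) * (2 * Real.pi) ^ 2 / 4 * (1 + 5 * 2 ^ 4 * Real.pi ^ (2 * (2 : ℕ) + 2) / (16 * (1 / 3 : ℝ)) ^ ((2 : ℕ) + 1))) + 2 * (27 * (2 : ℕ)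 * (2 * Real.pi) ^ 2 * Real.pi ^ (2 * (2 : ℕ) + 2) * 2 ^ 6 / (4 * (16 * (1 / 3 : ℝ)) ^ ((2 : ℕ) + 1))))) / (L : ℝ) ^ 2) := by
  intro L M _ _ hLM q x i
  obtain ⟨hAherm, hAti, hApsd, hA4, hcoer⟩ := cfl_scaled_facts (L := L) (M := M)
  have hc₀ : (0 : ℝ) < 1 / 3 := by norm_num
  have h1 : symbol (((1 / 3 : ℝ)) • NL[L,M]) 1 = 0 := by rw [symbol_smul, cfl_symbol_one, mul_zero]
  have hR : HasFiniteRange (tdist[L,M]) 1 (((1 / 3 : ℝ)) • NL[L,M]) := cfl_hasFiniteRange.smul _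
  have hLpos : (0 : ℝ) < (L : ℝ) := Nat.cast_pos.mpr (Nat.pos_of_ne_zero (NeZero.ne L))
  set τ := AddEquiv.prodCongr (AddEquiv.refl (TorusSite 2 L)) (AddEquiv.neg (ZMod M)) with hτ
  have hτA : ∀ a b : Λ L M, (((1 / 3 : ℝ)) • NL[L,M]) (τ a) (τ b) = (((1 / 3 : ℝ)) • NL[L,M]) a b := by
    intro a b; rw [Matrix.smul_apply, Matrix.smul_apply, cfl_reflect]
  -- constants
  set K₃ : ℝ := 27 * 2 * (2 * Real.pi) / 4 * (1 + 2 ^ 5 * Real.pi ^ 6 / (16 * (1 / 3 : ℝ)) ^ 3) with hK₃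
  set K₁ : ℝ := 27 * 2 * (2 * Real.pi) * Real.pi ^ 6 * 2 ^ 5 / (4 * (16 * (1 / 3 : ℝ)) ^ 3) with hK₁
  set Ks : ℝ := (27 * 2 * (2 * Real.pi) ^ 2 / 4 * (1 + 5 * 2 ^ 4 * Real.pi ^ 6 / (16 * (1 / 3 : ℝ)) ^ 3))
      + 2 * (27 * 2 * (2 * Real.pi) ^ 2 * Real.pi ^ 6 * 2 ^ 6 / (4 * (16 * (1 / 3 : ℝ)) ^ 3)) with hKs
  have hK₃0 : 0 ≤ K₃ := by rw [hK₃]; positivity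
  have hK₁0 : 0 ≤ K₁ := by rw [hK₁]; positivity
  have hKs0 : 0 ≤ Ks := by rw [hKs]; positivity
  -- the kernel bound, direction by direction
  have hker : ∀ (j : Fin 3) (y : Λ L M), |rowDiff (Evec[L,M] j) (pinv (NL[L,M])) (x - Evec[L,M] j) y|
      ≤ (3 : ℝ)⁻¹ * (2 * K₃) * (1 / max 1 (((((y.1 0 - (x - Evec[L,M] j).1 0).valMinAbs.natAbs
          + (y.1 1 - (x - Evec[L,M] j).1 1).valMinAbs.natAbs + (y.2 - (x - Evec[L,M] j).2).valMinAbs.natAbs : ℕ) : ℝ) - 1)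
            / (2 * 2 * 1))) ^ 2
        + (3 : ℝ)⁻¹ * (2 * K₁ + 16 * 2 * 1 * Ks) / (L : ℝ) ^ 2 := by
    intro j y
    set x' := x - Evec[L,M] j with hx'
    have hL2 : (0 : ℝ) < (L : ℝ) ^ 2 := by positivity
    rw [cf_pinv_NL, show rowDiff (Evec[L,M] j) ((3 : ℝ)⁻¹ • pinv (((1 / 3 : ℝ)) • NL[L,M])) x' y
        = (3 : ℝ)⁻¹ * rowDiff (Evec[L,M] j) (pinv (((1 / 3 : ℝ)) • NL[L,M])) x' y by
          rw [rowDiff_smul, Matrix.smul_apply, smul_eq_mul],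
      abs_mul, abs_of_pos (by norm_num : (0 : ℝ) < 3⁻¹)]
    by_cases hj : j = 2
    · -- the temporal step: the reflection device
      subst hj
      obtain ⟨hdec, hnD⟩ := gd_decompose x' y
      have h := abs_rowDiff_pinv_le_temporal_one (m := 2) (Evec[L,M]) (![L, L, M])
        (fun i => by fin_cases i <;> simp [NeZero.ne L, NeZero.ne M]) (fun i => cfrd_order i)
        (fun ψ φ h => cfrd_addChar_ext ψ φ h) cfrd_card rfl (by simpa using hLM)
        hAti hAherm hApsd hA4 hc₀ hcoer h1
        (fun i j k => cfrd_tdist_triangle i j k) (fun i => cfrd_tdist_self i) (fun i z => cfl_step_le_one i z)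
        hR le_rfl τ hτA gd_timeReflection_e2 le_rfl x' ((y - x').1, 0)
        (gd_timeReflection_spatial _) ((y - x').2.valMinAbs) (by rw [← hdec]; exact hnD)
      rw [← hdec] at h
      simp only [Nat.reduceAdd, Nat.reduceMul, Nat.cast_one, Nat.cast_ofNat, Matrix.cons_val_zero] at h ⊢
      rw [← hK₃, ← hKs] at h
      have hmul := mul_le_mul_of_nonneg_left h (by norm_num : (0 : ℝ) ≤ 3⁻¹)
      refine hmul.trans ?_
      have hx : 0 ≤ (3 : ℝ)⁻¹ * (2 * K₁) / (L : ℝ) ^ 2 := by positivity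
      have e : (3 : ℝ)⁻¹ * (2 * K₁ + 16 * 2 * 1 * Ks) / (L : ℝ) ^ 2
          = (3 : ℝ)⁻¹ * (2 * K₁) / (L : ℝ) ^ 2 + (3 : ℝ)⁻¹ * (16 * 2 * 1 * Ks / (L : ℝ) ^ 2) := by ring
      rw [e]
      linarith
    · -- a spatial step
      have hspat : ∃ g ∈ [Evec[L,M] j], g = Evec[L,M] 0 ∨ g = -(Evec[L,M] 0) ∨ g = Evec[L,M] 1 ∨ g = -(Evec[L,M] 1) := by
        refine ⟨Evec[L,M] j, List.mem_singleton_self _, ?_⟩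
        fin_cases j
        · exact Or.inl rfl
        · exact Or.inr (Or.inr (Or.inl rfl))
        · exact absurd rfl hj
      have h := abs_rowDiffs_pinv_le_spatial (m := 2) (Evec[L,M]) (![L, L, M])
        (fun i => by fin_cases i <;> simp [NeZero.ne L, NeZero.ne M]) (fun i => cfrd_order i)
        (fun ψ φ h => cfrd_addChar_ext ψ φ h) cfrd_card rfl (by simpa using hLM)
        hAti hAherm hApsd hA4 hc₀ hcoer h1
        (fun i j k => cfrd_tdist_triangle i j k) (fun i => cfrd_tdist_self i) (fun i z => cfl_step_le_one i z)
        hR [Evec[L,M] j] (fun g hg => ⟨j, Or.inl (List.mem_singleton.1 hg)⟩) hspat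
        (by simp only [List.length_cons, List.length_nil]; omega) x' y
      simp only [List.length_cons, List.length_nil, zero_add, Nat.reduceAdd, Nat.reduceMul, pow_one, Nat.cast_one, Nat.cast_ofNat,
        Matrix.cons_val_zero, rowDiffs_cons, rowDiffs_nil] at h ⊢
      rw [← hK₃, ← hK₁] at h
      have hmul := mul_le_mul_of_nonneg_left h (by norm_num : (0 : ℝ) ≤ 3⁻¹)
      have e3 : (1 / (L : ℝ)) ^ 2 = 1 / (L : ℝ) ^ 2 := by rw [one_div_pow]
      rw [e3] at hmul
      refine hmul.trans ?_
      have hx : 0 ≤ (3 : ℝ)⁻¹ * (16 * 2 * 1 * Ks) / (L : ℝ) ^ 2 := by positivity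
      have e : (3 : ℝ)⁻¹ * (2 * K₁ + 16 * 2 * 1 * Ks) / (L : ℝ) ^ 2
          = (3 : ℝ)⁻¹ * (2 * K₁ * (1 / (L : ℝ) ^ 2)) + (3 : ℝ)⁻¹ * (16 * 2 * 1 * Ks) / (L : ℝ) ^ 2 := by
        field_simp
      rw [e]
      linarith
  -- assemble
  rw [cf_coexact_eq]
  refine (Finset.abs_sum_le_sum_abs _ _).trans (Finset.sum_le_sum fun j _ => ?_)
  refine (Finset.abs_sum_le_sum_abs _ _).trans (Finset.sum_le_sum fun y _ => ?_)
  rw [abs_mul, mul_comm]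
  refine mul_le_mul_of_nonneg_left ?_ (abs_nonneg _)
  have h := hker j y
  rw [hK₃, hK₁, hKs] at h
  simp only [Nat.reduceAdd, Nat.reduceMul, Nat.cast_one, Nat.cast_ofNat] at h ⊢
  exact h

end CoulombField

end Summit.HubbardSuperconductivity.HubbardSuperconductivity.Theorems

end
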